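import Summits.HodgeConjecture.HodgeConjecture.Theorems.PadicSemiregularLiftFormalLiftingFromClassLiftingKernelPresentation
import Summits.HodgeConjecture.HodgeConjecture.Theorems.PadicSemiregularLiftFormalLiftingFromClassLiftingLogLift
import Summits.HodgeConjecture.HodgeConjecture.Theorems.PadicSemiregularLiftFormalLiftingFromClassLiftingTowerSheaves
import Summits.HodgeConjecture.HodgeConjecture.Theorems.PadicSemiregularLiftFormalLiftingFromClassLiftingCechOneCocycleLift
import Summits.HodgeConjecture.HodgeConjecture.Theorems.PadicSemiregularLiftFormalLiftingFromClassLiftingTruncatedExpLog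
import Summits.HodgeConjecture.HodgeConjecture.Theorems.PadicSemiregularLiftFormalLiftingFromClassLiftingTeichmuellerTransport

/-!
# `FormalLiftingFromClassLifting` (stmt-HodgeConjecture-13825) · line `IdeatorFiveSketch` · stub S4
# (2_Pic): line-bundle classes on `X_{n+1}` dying on the special fibre lift to `X_{n+2}`

Registered stub `stub_picKernelLift` of the weight-one-first skeleton of the crux
`PadicSemiregularLift.FormalLiftingFromClassLifting` (lead prover-line-stmt-HodgeConjecture-13825-c1-0).
Its hypotheses are the statements of the sibling stubs S1–S3 (registered with the wave; the landed
theorems are used by name) and the support statements T (a datum presenting a cocycle on `X_n`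
defines a unit cocycle) and P (a class dying on `X_k` is presented by an affine datum `≡ 1 (mod p)`); the
conclusion is (2_Pic): for `𝒳` flat and separated over `W(k)`, `p ≠ 2`, `H²(𝒳, 𝒪)[p] = 0`, every
`u ∈ Ȟ¹(X_{n+1}, 𝒪^×)` with `u|_{X_k} = 1` is `u'|_{X_{n+1}}` for some `u' ∈ Ȟ¹(X_{n+2}, 𝒪^×)`.

Proof: present `u` by `(A, W)` with `W = 1 + p w` (P); `Λ_n(w)` is an additive `1`-cocycle of
`(ι_n)_* 𝒪_{X_n}` (`log_cocycle`); lift it along `(ι_{n+1})_* 𝒪 → (ι_n)_* 𝒪`, onto on `H¹` by the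
landed S1 (`surjective_H_map_transition`), to `b` after refinement modulo a `0`-cochain (landed S2);
lift `b` to `𝒳`, solve `Λ_{n+1}(x̂) ≡ b` (landed S3) and exponentiate to a datum `1 + p x̂` on
`X_{n+2}` (`datum_of_log_lift`), whose class restricts on `X_{n+1}` to that of `(A, W)` through the
units `1 + p ζ` (`rel_of_log_lift`, T, pull-back of data). The last section assembles THE WEIGHT-ONE
ENGINE `detClass_extends` (registered): with the landed Teichmüller transport (S5) and the level-wise
lifts of `det[E₁]^N` (`detPow_lifts_all_levels`), the determinant class of every finite-level lift of a
rationally pro-liftable `E₁` extends one step. Everything is proved; no definitions, no notation.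
-/

set_option linter.dupNamespace false

namespace Summit.HodgeConjecture.HodgeConjecture.Theorems.FormalLiftingFromClassLifting.WeightOne

open CategoryTheory AlgebraicGeometry Limits Opposite TopologicalSpace
open Literature.AlgebraicGeometry Literature.AlgebraicGeometry.Motives
open Literature.AlgebraicGeometry.Motives.WittScheme
open Literature.AlgebraicGeometry.Modules (CechPic UnitCocycle detClass detClass_pullback)
open Summit.HodgeConjecture.HodgeConjecture.Theorems.FormalVectorBundlesAlgebraize
  (thickeningι_cutOut mul_p_injective_sections mul_p_pow_injective_sections)

noncomputable section

variable {p : ℕ} [Fact p.Prime] {k : Type} [Field k] (𝒳 : SchemeOver (WittVector p k))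


set_option maxHeartbeats 1600000 in
-- one long construction over the sections of three thickenings; many small rewrites
/-- **S4 = (2_Pic): line-bundle classes on `X_{n+1}` dying on the special fibre lift to `X_{n+2}`**
(registered stub `stub_picKernelLift` of the weight-one-first skeleton of
`PadicSemiregularLift.FormalLiftingFromClassLifting`; hypotheses: the statements of S1, S2, S3 (as
registered when the wave was launched; the proof uses the landed S1 `stub_h1MapSurjective`, S2
`stub_cechOneCocycleLift`, S3 `stub_truncatedExpLog` by name instead) and the support statements T, P).
Proof: present `u` by `(A, W)` with `W = 1 + p w` (P); `a := ι_n^♯ Λ_n(w)` is an additive `1`-cocycle of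
`(ι_n)_*𝒪` (S3 (b),(f) and flatness); lift it along `(ι_{n+1})_*𝒪 → (ι_n)_*𝒪`, onto on `H¹` by S1, to
`b` after refinement `W'` modulo `∂z` (S2); lift `b` to `X̂` on `𝒳`, solve `Λ_{n+1}(x̂) ≡ X̂` (S3 (d)) and
put `Ĝ := 1 + p x̂`: a datum on `X_{n+2}` (S3 (c)), whose class `u'` restricts on `X_{n+1}` to the class
of `(W', Ĝ)` (T, pull-back of data), which equals `u` by the units `1 + p ζ`, `Λ_n(ζ) ≡ Z`, `Z` lifting
`z` (S3 (b),(c),(e)). -/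
theorem stub_picKernelLift :
      (∀ (X : Scheme.{0}) (q : ℕ),
        (∀ U : X.Opens, IsAffineOpen U →
          ∀ s : (structureSheafAb X).obj.obj (op U), q • s = 0 → s = 0) →
        (∀ x : structureSheafCohomology X 2, (q : ℤ) • x = 0 → x = 0) →
        ∀ (F : Sheaf (Opens.grothendieckTopology X) AddCommGrpCat.{0}) (r : structureSheafAb X ⟶ F),
          (∀ U : X.Opens, IsAffineOpen U → Function.Surjective (r.hom.app (op U))) →
          (∀ U : X.Opens, IsAffineOpen U → ∀ s : (structureSheafAb X).obj.obj (op U),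
            r.hom.app (op U) s = 0 ↔ ∃ t : (structureSheafAb X).obj.obj (op U), s = q • t) →
          Function.Surjective
            (Sheaf.H.map r 1 : Sheaf.H.{0} (structureSheafAb X) 1 → Sheaf.H.{0} F 1)) →
      (∀ (X : TopCat.{0}) (F G : Sheaf (Opens.grothendieckTopology X) AddCommGrpCat.{0}) (φ : F ⟶ G),
        Function.Surjective (Sheaf.H.map φ 1 : Sheaf.H.{0} F 1 → Sheaf.H.{0} G 1) →
        ∀ (B : Set (Opens X)), Opens.IsBasis B →
        ∀ (U : X → Opens X), (∀ x, x ∈ U x) →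
        ∀ (c : ∀ x y : X, G.obj.obj (op (U x ⊓ U y))),
          (∀ x y z : X,
            sheafSecRes G (le_inf (inf_le_left.trans inf_le_right) inf_le_right :
                U x ⊓ U y ⊓ U z ≤ U y ⊓ U z) (c y z) -
              sheafSecRes G (le_inf (inf_le_left.trans inf_le_left) inf_le_right :
                U x ⊓ U y ⊓ U z ≤ U x ⊓ U z) (c x z) +
              sheafSecRes G (inf_le_left : U x ⊓ U y ⊓ U z ≤ U x ⊓ U y) (c x y) = 0) →
          ∃ (W : X → Opens X) (_ : ∀ x, x ∈ W x) (hWU : ∀ x, W x ≤ U x) (_ : ∀ x, W x ∈ B)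
            (b : ∀ x y : X, F.obj.obj (op (W x ⊓ W y)))
            (_ : ∀ x y z : X,
              sheafSecRes F (le_inf (inf_le_left.trans inf_le_right) inf_le_right :
                  W x ⊓ W y ⊓ W z ≤ W y ⊓ W z) (b y z) -
                sheafSecRes F (le_inf (inf_le_left.trans inf_le_left) inf_le_right :
                  W x ⊓ W y ⊓ W z ≤ W x ⊓ W z) (b x z) +
                sheafSecRes F (inf_le_left : W x ⊓ W y ⊓ W z ≤ W x ⊓ W y) (b x y) = 0)
            (z : ∀ x : X, G.obj.obj (op (W x))),
            ∀ x y : X,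
              sheafSecRes G (inf_le_inf (hWU x) (hWU y)) (c x y) =
                φ.hom.app (op (W x ⊓ W y)) (b x y) +
                  (sheafSecRes G inf_le_right (z y) - sheafSecRes G inf_le_left (z x))) →
      (∀ (p : ℕ), p.Prime → p ≠ 2 → ∃ (d : ℕ → ℕ) (γ : ℕ → ℕ → ℤ),
        ∀ (R : Type) [CommRing R] (M : ℕ),
          (∀ x : R, (1 + p * x) ^ (p ^ M) =
            1 + (p : R) ^ (M + 1) * ∑ j ∈ Finset.range (d M), (γ M j : R) * x ^ (j + 1)) ∧
          (∀ x y : R, ∃ w : R,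
            (∑ j ∈ Finset.range (d M), (γ M j : R) * (x + y + p * x * y) ^ (j + 1)) =
              (∑ j ∈ Finset.range (d M), (γ M j : R) * x ^ (j + 1)) +
                (∑ j ∈ Finset.range (d M), (γ M j : R) * y ^ (j + 1)) + (p : R) ^ M * w) ∧
          (∀ x x' : R,
            (∃ w : R, (∑ j ∈ Finset.range (d M), (γ M j : R) * x' ^ (j + 1)) =
              (∑ j ∈ Finset.range (d M), (γ M j : R) * x ^ (j + 1)) + (p : R) ^ M * w) →
            ∃ w : R, x' = x + (p : R) ^ M * w) ∧
          (∀ y : R, ∃ x w : R,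
            (∑ j ∈ Finset.range (d M), (γ M j : R) * x ^ (j + 1)) = y + (p : R) ^ M * w) ∧
          (∀ x : R, ∃ w : R,
            (∑ j ∈ Finset.range (d (M + 1)), (γ (M + 1) j : R) * x ^ (j + 1)) =
              (∑ j ∈ Finset.range (d M), (γ M j : R) * x ^ (j + 1)) + (p : R) ^ (M + 1) * w) ∧
          (∀ x w : R, ∃ w' : R,
            (∑ j ∈ Finset.range (d M), (γ M j : R) * (x + (p : R) ^ M * w) ^ (j + 1)) =
              (∑ j ∈ Finset.range (d M), (γ M j : R) * x ^ (j + 1)) + (p : R) ^ M * w')) →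
      (∀ (p : ℕ) [Fact p.Prime] (k : Type) [Field k] (𝒳 : SchemeOver (WittVector p k)) (n : ℕ)
        (A : 𝒳.left → 𝒳.left.Opens), (∀ x, x ∈ A x) →
        ∀ (G : ∀ x y : 𝒳.left, Γ(𝒳.left, A x ⊓ A y)),
        (∀ x y z : 𝒳.left,
          (thickeningι 𝒳 n).app (A x ⊓ A y ⊓ A z)
            (𝒳.left.presheaf.map (homOfLE inf_le_left).op (G x y) *
              𝒳.left.presheaf.map
                (homOfLE (le_inf (inf_le_left.trans inf_le_right) inf_le_right)).op (G y z)) =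
          (thickeningι 𝒳 n).app (A x ⊓ A y ⊓ A z)
            (𝒳.left.presheaf.map
              (homOfLE (le_inf (inf_le_left.trans inf_le_left) inf_le_right)).op (G x z))) →
        (∀ x : 𝒳.left, (thickeningι 𝒳 n).app (A x ⊓ A x) (G x x) = 1) →
        ∃ (C : UnitCocycle (thickening 𝒳 n).left)
          (hU : ∀ z, C.U z = (thickeningι 𝒳 n) ⁻¹ᵁ A ((thickeningι 𝒳 n).base z)),
          ∀ (z z' : (thickening 𝒳 n).left) (V : (thickening 𝒳 n).left.Opens)
            (hz : V ≤ C.U z) (hz' : V ≤ C.U z'),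
            C.g z z' V hz hz' = (thickeningι 𝒳 n).appLE
              (A ((thickeningι 𝒳 n).base z) ⊓ A ((thickeningι 𝒳 n).base z')) V
              (UnitCocycle.le_preimage_inf _ (hz.trans (hU z).le) (hz'.trans (hU z').le))
              (G ((thickeningι 𝒳 n).base z) ((thickeningι 𝒳 n).base z'))) →
      (∀ (p : ℕ) [Fact p.Prime] (k : Type) [Field k] [CharP k p] [PerfectRing k p]
        (𝒳 : SchemeOver (WittVector p k)) [IsSeparated 𝒳.hom] (n : ℕ)
        (u : CechPic (thickening 𝒳 (n + 1)).left),
        CechPic.pullback (specialFibreToThickening 𝒳 n) u = 1 →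
        ∃ (A : 𝒳.left → 𝒳.left.Opens) (_ : ∀ x, x ∈ A x) (_ : ∀ x, IsAffineOpen (A x))
          (_ : ∀ x, x ∉ Set.range (thickeningι 𝒳 (n + 1)).base →
            ∀ q ∈ A x, q ∉ Set.range (thickeningι 𝒳 (n + 1)).base)
          (W : ∀ x y : 𝒳.left, Γ(𝒳.left, A x ⊓ A y)),
          (∀ x y z : 𝒳.left,
            (thickeningι 𝒳 (n + 1)).app (A x ⊓ A y ⊓ A z)
              (𝒳.left.presheaf.map (homOfLE inf_le_left).op (W x y) *
                𝒳.left.presheaf.map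
                  (homOfLE (le_inf (inf_le_left.trans inf_le_right) inf_le_right)).op (W y z)) =
            (thickeningι 𝒳 (n + 1)).app (A x ⊓ A y ⊓ A z)
              (𝒳.left.presheaf.map
                (homOfLE (le_inf (inf_le_left.trans inf_le_left) inf_le_right)).op (W x z))) ∧
          (∀ x : 𝒳.left, (thickeningι 𝒳 (n + 1)).app (A x ⊓ A x) (W x x) = 1) ∧
          (∀ x y : 𝒳.left, ∃ w : Γ(𝒳.left, A x ⊓ A y),
            W x y = 1 + (p : Γ(𝒳.left, A x ⊓ A y)) * w) ∧
          ∀ (C : UnitCocycle (thickening 𝒳 (n + 1)).left)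
            (hU : ∀ z, C.U z = (thickeningι 𝒳 (n + 1)) ⁻¹ᵁ A ((thickeningι 𝒳 (n + 1)).base z)),
            (∀ (z z' : (thickening 𝒳 (n + 1)).left) (V : (thickening 𝒳 (n + 1)).left.Opens)
              (hz : V ≤ C.U z) (hz' : V ≤ C.U z'),
              C.g z z' V hz hz' = (thickeningι 𝒳 (n + 1)).appLE
                (A ((thickeningι 𝒳 (n + 1)).base z) ⊓ A ((thickeningι 𝒳 (n + 1)).base z')) V
                (UnitCocycle.le_preimage_inf _ (hz.trans (hU z).le) (hz'.trans (hU z').le))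
                (W ((thickeningι 𝒳 (n + 1)).base z) ((thickeningι 𝒳 (n + 1)).base z'))) →
            CechPic.mk C = u) →
    ∀ (p : ℕ) [Fact p.Prime] (k : Type) [Field k] [CharP k p] [PerfectRing k p]
      (𝒳 : SchemeOver (WittVector p k)) [Flat 𝒳.hom] [IsSeparated 𝒳.hom], p ≠ 2 →
      (∀ x : structureSheafCohomology 𝒳.left 2, (p : ℤ) • x = 0 → x = 0) →
      ∀ (n : ℕ) (u : CechPic (thickening 𝒳 (n + 1)).left),
        CechPic.pullback (specialFibreToThickening 𝒳 n) u = 1 →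
        ∃ u' : CechPic (thickening 𝒳 (n + 2)).left,
          CechPic.pullback (thickeningMap 𝒳 (Nat.le_succ (n + 1))) u' = u := by
  intro _ _ _ hT hP p _ k _ _ _ 𝒳 _ _ hp2 hO n u hu
  classical
  obtain ⟨Λ, hΛnat, -, hΛ⟩ := exists_log_package p Fact.out hp2
  -- (P) presentation of `u`
  obtain ⟨A, hxA, hAaff, hAgen, W, hWmul, hWself, hWmodp, hWclass⟩ := hP p k 𝒳 n u hu
  choose w hw using hWmodp
  have hAxy : ∀ x y, IsAffineOpen (A x ⊓ A y) := fun x y => isAffineOpen_inf 𝒳 (hAaff x) (hAaff y)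
  have hAxyz : ∀ x y z, IsAffineOpen (A x ⊓ A y ⊓ A z) := fun x y z => isAffineOpen_inf 𝒳 (hAxy x y) (hAaff z)
  ------------------------------------------------------------------------------------------------
  -- Step 2: the additive `1`-cocycle `a := ι_n^♯ Λ_n(w)` of `(ι_n)_* 𝒪`
  ------------------------------------------------------------------------------------------------
  -- the key ring identity on triple intersections: `Λ(w_yz) - Λ(w_xz) + Λ(w_xy) ∈ pⁿ Γ`
  have hcoc : ∀ x y z : 𝒳.left, ∃ E : Γ(𝒳.left, A x ⊓ A y ⊓ A z),
      Λ _ n (𝒳.left.presheaf.map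
          (homOfLE (le_inf (inf_le_left.trans inf_le_right) inf_le_right)).op (w y z)) -
        Λ _ n (𝒳.left.presheaf.map
          (homOfLE (le_inf (inf_le_left.trans inf_le_left) inf_le_right)).op (w x z)) +
        Λ _ n (𝒳.left.presheaf.map (homOfLE inf_le_left).op (w x y)) =
      (p : Γ(𝒳.left, A x ⊓ A y ⊓ A z)) ^ n * E := by
    intro x y z
    refine log_cocycle 𝒳 n Λ hΛ (hAxyz x y z) _ _ _ ?_
    -- from the cocycle identity of `W = 1 + p w` on `X_{n+1}`
    have e := hWmul x y z
    rw [hw x y, hw y z, hw x z] at e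
    simp only [map_add, map_mul, map_one, map_natCast] at e
    rw [map_sub]
    simp only [map_add, map_mul, map_one, map_natCast]
    rw [e, sub_self]
  ------------------------------------------------------------------------------------------------
  -- Step 3: lift the additive cocycle `ι_n^♯ Λ_n(w)` to `(ι_{n+1})_* 𝒪` after refinement (S2, S1)
  ------------------------------------------------------------------------------------------------
  obtain ⟨t, ht⟩ := exists_transitionHom 𝒳 (Nat.le_succ n)
  have hφ := surjective_H_map_transition 𝒳 hO (Nat.le_succ n) t ht
  obtain ⟨W', hW'mem, hW'A, hW'aff, b, hb, zc, hrel⟩ := stub_cechOneCocycleLift _ _ _ t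
    hφ 𝒳.left.affineOpens 𝒳.left.isBasis_affineOpens A hxA
    (fun x y => show ((((Opens.map (thickeningι 𝒳 n).base).sheafPushforwardContinuous
        AddCommGrpCat.{0} (Opens.grothendieckTopology 𝒳.left)
        (Opens.grothendieckTopology (thickening 𝒳 n).left)).obj
        (structureSheafAb (thickening 𝒳 n).left))).obj.obj (op (A x ⊓ A y)) from
      (thickeningι 𝒳 n).app (A x ⊓ A y) (Λ _ n (w x y))) (by
      intro x y z
      obtain ⟨E, hE⟩ := hcoc x y z
      have key := congrArg ((thickeningι 𝒳 n).app (A x ⊓ A y ⊓ A z)) hE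
      rw [map_add, map_sub, ← hΛnat, ← hΛnat, ← hΛnat, thickeningι_app_res, thickeningι_app_res,
        thickeningι_app_res, app_thickeningι_pow_mul] at key
      rw [sheafSecRes_pushforward, sheafSecRes_pushforward, sheafSecRes_pushforward]
      exact key)
  have hW'aff' : ∀ x, IsAffineOpen (W' x) := fun x => hW'aff x
  have hW'xy : ∀ x y, IsAffineOpen (W' x ⊓ W' y) := fun x y => isAffineOpen_inf 𝒳 (hW'aff' x) (hW'aff' y)
  have hW'xyz : ∀ x y z, IsAffineOpen (W' x ⊓ W' y ⊓ W' z) := fun x y z =>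
    isAffineOpen_inf 𝒳 (hW'xy x y) (hW'aff' z)
  ------------------------------------------------------------------------------------------------
  -- Step 4: lift `b` to `𝒳`, solve `Λ_{n+1}(x̂) ≡ B̂`, and form the datum `Ĝ := 1 + p x̂` on `X_{n+2}`
  ------------------------------------------------------------------------------------------------
  have hBex : ∀ x y, ∃ Bxy : Γ(𝒳.left, W' x ⊓ W' y),
      (thickeningι 𝒳 (n + 1)).app (W' x ⊓ W' y) Bxy = b x y :=
    fun x y => (thickeningι_cutOut 𝒳 (n + 1) (hW'xy x y)).1 (b x y)
  choose B hB using hBex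
  have hBcoc : ∀ x y z : 𝒳.left, ∃ e : Γ(𝒳.left, W' x ⊓ W' y ⊓ W' z),
      𝒳.left.presheaf.map
          (homOfLE (le_inf (inf_le_left.trans inf_le_right) inf_le_right)).op (B y z) -
        𝒳.left.presheaf.map
          (homOfLE (le_inf (inf_le_left.trans inf_le_left) inf_le_right)).op (B x z) +
        𝒳.left.presheaf.map (homOfLE inf_le_left).op (B x y) =
      (p : Γ(𝒳.left, W' x ⊓ W' y ⊓ W' z)) ^ (n + 1) * e := by
    intro x y z
    refine exists_eq_pow_mul_of_app_thickeningι_eq_zero 𝒳 (n + 1) (hW'xyz x y z) _ ?_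
    have hb' := hb x y z
    rw [sheafSecRes_pushforward, sheafSecRes_pushforward, sheafSecRes_pushforward, ← hB y z,
      ← hB x z, ← hB x y] at hb'
    rw [map_add, map_sub, thickeningι_app_res, thickeningι_app_res, thickeningι_app_res]
    exact hb'
  have hXex : ∀ x y, ∃ xh j : Γ(𝒳.left, W' x ⊓ W' y),
      Λ _ (n + 1) xh = B x y + (p : Γ(𝒳.left, W' x ⊓ W' y)) ^ (n + 1) * j :=
    fun x y => (hΛ _ (n + 1)).2.2.1 (B x y)
  choose xh jx hxh using hXex
  obtain ⟨Gh, hGh⟩ : ∃ Gh : ∀ x y : 𝒳.left, Γ(𝒳.left, W' x ⊓ W' y),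
      ∀ x y, Gh x y = 1 + (p : Γ(𝒳.left, W' x ⊓ W' y)) * xh x y := ⟨_, fun _ _ => rfl⟩
  obtain ⟨hmul2, hself2⟩ := datum_of_log_lift p k 𝒳 n Λ hΛnat hΛ W' B xh jx Gh hBcoc hxh hGh
  -- the same datum on `X_{n+1}` (restriction along the transition)
  have hmul1 : ∀ x y z : 𝒳.left,
      (thickeningι 𝒳 (n + 1)).app (W' x ⊓ W' y ⊓ W' z)
        (𝒳.left.presheaf.map (homOfLE inf_le_left).op (Gh x y) *
          𝒳.left.presheaf.map
            (homOfLE (le_inf (inf_le_left.trans inf_le_right) inf_le_right)).op (Gh y z)) =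
      (thickeningι 𝒳 (n + 1)).app (W' x ⊓ W' y ⊓ W' z)
        (𝒳.left.presheaf.map
          (homOfLE (le_inf (inf_le_left.trans inf_le_left) inf_le_right)).op (Gh x z)) := by
    intro x y z
    rw [← transition_app_apply 𝒳 (Nat.le_succ (n + 1)), hmul2 x y z, transition_app_apply]
  have hself1 : ∀ x : 𝒳.left, (thickeningι 𝒳 (n + 1)).app (W' x ⊓ W' x) (Gh x x) = 1 := by
    intro x
    rw [← transition_app_apply 𝒳 (Nat.le_succ (n + 1)), hself2 x, map_one]
  obtain ⟨C', hU', hg'⟩ := hT p k 𝒳 (n + 2) W' hW'mem Gh hmul2 hself2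
  obtain ⟨C'', hU'', hg''⟩ := hT p k 𝒳 (n + 1) W' hW'mem Gh hmul1 hself1
  obtain ⟨CA, hUA, hgA⟩ := hT p k 𝒳 (n + 1) A hxA W hWmul hWself
  ------------------------------------------------------------------------------------------------
  -- Step 5: `[(W', Ĝ)] = [(A, W)] = u` on `X_{n+1}` through the units `1 + p ζ`, `Λ_n(ζ) ≡ -Z`
  ------------------------------------------------------------------------------------------------
  have hZex : ∀ x, ∃ Zx : Γ(𝒳.left, W' x), (thickeningι 𝒳 n).app (W' x) Zx = zc x :=
    fun x => (thickeningι_cutOut 𝒳 n (hW'aff' x)).1 (zc x)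
  choose Z hZ using hZex
  have hζex : ∀ x, ∃ ζx j : Γ(𝒳.left, W' x), Λ _ n ζx = -Z x + (p : Γ(𝒳.left, W' x)) ^ n * j :=
    fun x => (hΛ _ n).2.2.1 (-Z x)
  choose ζ jz hζ using hζex
  obtain ⟨μ, hμdef⟩ : ∃ μ : ∀ x : 𝒳.left, Γ(𝒳.left, W' x),
      ∀ x, μ x = 1 + (p : Γ(𝒳.left, W' x)) * ζ x := ⟨_, fun _ => rfl⟩
  have hμ : ∀ x, IsUnit ((thickeningι 𝒳 (n + 1)).app (W' x) (μ x)) := by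
    intro x
    rw [hμdef, map_add, map_one, map_mul, map_natCast]
    exact isUnit_one_add_p_mul 𝒳 (n + 1) _
  -- the key congruence `Λ_n(w) ≡ B̂ + Z_y - Z_x (mod pⁿ)` from the relation `a = t(b) + ∂z` of S2
  have hE : ∀ x y, ∃ e : Γ(𝒳.left, W' x ⊓ W' y),
      𝒳.left.presheaf.map (homOfLE (inf_le_inf (hW'A x) (hW'A y))).op (Λ _ n (w x y)) - B x y -
        𝒳.left.presheaf.map (homOfLE inf_le_right).op (Z y) +
        𝒳.left.presheaf.map (homOfLE inf_le_left).op (Z x) =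
      (p : Γ(𝒳.left, W' x ⊓ W' y)) ^ n * e := by
    intro x y
    refine exists_eq_pow_mul_of_app_thickeningι_eq_zero 𝒳 n (hW'xy x y) _ ?_
    have hr := hrel x y
    dsimp only at hr
    rw [sheafSecRes_pushforward, sheafSecRes_pushforward, sheafSecRes_pushforward, ← hB x y,
      ht, transition_app_apply, ← hZ x, ← hZ y] at hr
    -- the same relation, read in the ring of sections of `X_n`
    have hr' : (thickening 𝒳 n).left.presheaf.map (homOfLE
          (show (thickeningι 𝒳 n) ⁻¹ᵁ (W' x ⊓ W' y) ≤ (thickeningι 𝒳 n) ⁻¹ᵁ (A x ⊓ A y) from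
            fun _ hq => (inf_le_inf (hW'A x) (hW'A y)) hq)).op
          ((thickeningι 𝒳 n).app (A x ⊓ A y) (Λ _ n (w x y))) =
        (thickeningι 𝒳 n).app (W' x ⊓ W' y) (B x y) +
          ((thickening 𝒳 n).left.presheaf.map (homOfLE
              (show (thickeningι 𝒳 n) ⁻¹ᵁ (W' x ⊓ W' y) ≤ (thickeningι 𝒳 n) ⁻¹ᵁ (W' y) from
                fun _ hq => (inf_le_right : W' x ⊓ W' y ≤ W' y) hq)).op
              ((thickeningι 𝒳 n).app (W' y) (Z y)) -
            (thickening 𝒳 n).left.presheaf.map (homOfLE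
              (show (thickeningι 𝒳 n) ⁻¹ᵁ (W' x ⊓ W' y) ≤ (thickeningι 𝒳 n) ⁻¹ᵁ (W' x) from
                fun _ hq => (inf_le_left : W' x ⊓ W' y ≤ W' x) hq)).op
              ((thickeningι 𝒳 n).app (W' x) (Z x))) := hr
    rw [map_add, map_sub, map_sub, thickeningι_app_res, thickeningι_app_res, thickeningι_app_res,
      hr']
    abel
  have hrelμ : ∀ x y : 𝒳.left,
      (thickeningι 𝒳 (n + 1)).app (W' x ⊓ W' y)
        (𝒳.left.presheaf.map (homOfLE (inf_le_inf (hW'A x) (hW'A y))).op (W x y) *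
          𝒳.left.presheaf.map (homOfLE inf_le_right).op (μ y)) =
      (thickeningι 𝒳 (n + 1)).app (W' x ⊓ W' y)
        (𝒳.left.presheaf.map (homOfLE inf_le_left).op (μ x) * Gh x y) := by
    intro x y
    obtain ⟨e, he⟩ := hE x y
    rw [hw x y, hμdef y, hμdef x, hGh x y]
    exact rel_of_log_lift 𝒳 n Λ hΛnat hΛ (inf_le_inf (hW'A x) (hW'A y)) (w x y) (B x y) (xh x y)
      (jx x y) e (Z x) (ζ x) (jz x) (Z y) (ζ y) (jz y) he (hxh x y) (hζ x) (hζ y)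
  refine ⟨CechPic.mk C', ?_⟩
  exact (pullback_mk_eq_mk_of_datum 𝒳 (Nat.le_succ (n + 1)) W' Gh C' hU' hg' C'' hU'' hg'').trans
    ((mk_eq_mk_of_units 𝒳 (n + 1) A W' hW'A W Gh CA hUA hgA C'' hU'' hg'' μ hμ hrelμ).symm.trans
      (hWclass CA hUA hgA))

section Engine

/-- **THE WEIGHT-ONE ENGINE** (registered support statement `detClass_extends` of the line): for `𝒳`
flat and separated over `W(k)`, `p ≠ 2`, `H²(𝒳,𝒪)[p] = 0`, and `E₁` finite locally free on `X_k` with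
a rationally pro-liftable class, the determinant class of EVERY finite-level finite locally free
lift `F` of `E₁` to `X_{n+1}` extends to `X_{n+2}`. [folklore] -/
theorem detClass_extends :
    ∀ (p : ℕ) [Fact p.Prime] (k : Type) [Field k] [CharP k p] [PerfectRing k p]
      (𝒳 : SchemeOver (WittVector p k)) [Flat 𝒳.hom] [IsSeparated 𝒳.hom], p ≠ 2 →
      (∀ x : structureSheafCohomology 𝒳.left 2, (p : ℤ) • x = 0 → x = 0) →
      ∀ (E₁ : (specialFibre 𝒳).left.Modules) (hE₁ : IsFiniteLocallyFree E₁),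
        (∃ ξ : KTheory.ContinuousKZeroRat (Ideal.span {(p : WittVector p k)}) 𝒳,
          KTheory.KZeroRat.map (Crystalline.specialFibreToTower 𝒳)
            (KTheory.ContinuousKZeroRat.specialFibre (Ideal.span {(p : WittVector p k)}) 𝒳 ξ) =
            KTheory.KZeroRat.of E₁ hE₁) →
        ∀ (n : ℕ) (F : (thickening 𝒳 (n + 1)).left.Modules) (hF : IsFiniteLocallyFree F),
          Nonempty ((Scheme.Modules.pullback (specialFibreToThickening 𝒳 n)).obj F ≅ E₁) →
          ∃ c' : CechPic (thickening 𝒳 (n + 2)).left,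
            CechPic.pullback (thickeningMap 𝒳 (Nat.le_succ (n + 1))) c' = detClass hF := by
  intro p _ k _ _ _ 𝒳 _ _ hp hO E₁ hE₁ hξ n F hF hFE
  obtain ⟨N, hN, hlift⟩ := detPow_lifts_all_levels 𝒳 hE₁ hξ
  -- `N = p^e * N'` with `p ∤ N'`
  obtain ⟨e, N', hN', hNe⟩ := Nat.exists_eq_pow_mul_and_not_dvd hN.ne' p (Fact.out : p.Prime).ne_one
  obtain ⟨i⟩ := hFE
  -- the restriction of `det[F]` to `X_k` is `det[E₁]`
  have hres : CechPic.pullback (specialFibreToThickening 𝒳 n) (detClass hF) = detClass hE₁ := by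
    rw [← detClass_pullback, detClass_eq_of_iso i]
  refine stub_teichmuellerTransport p k 𝒳 hp n e N' hN'
    (fun u hu => stub_picKernelLift stub_h1MapSurjective.{0} stub_cechOneCocycleLift.{0}
      stub_truncatedExpLog stub_towerDatumCocycle stub_kernelPresentation p k 𝒳 hp hO (n + e) u hu)
    (detClass hF) ?_
  obtain ⟨c, hc⟩ := hlift (n + e + 1)
  exact ⟨c, by rw [hc, hres, hNe]⟩

end Engine

end

end Summit.HodgeConjecture.HodgeConjecture.Theorems.FormalLiftingFromClassLifting.WeightOne
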